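import Literature.InformationTheory.QuantumCodes.QuasiAbelianLPDistance
import Literature.InformationTheory.QuantumCodes.AbelianTwoBlockHypergraphProduct
import Literature.InformationTheory.QuantumCodes.CSSEquivalence
import Literature.InformationTheory.QuantumCodes.HypergraphProductSectorDistances
import Mathlib.GroupTheory.QuotientGroup.Defs
import Mathlib.GroupTheory.Coset.Card
import HarnessLib

/-!
# Abelian two-block codes ARE quasi-abelian lifted-product codes over `F[N]`, `N = G_a ∩ G_b`
# (Lin–Pryadko 2024, Statement 8 / §VIII.C, abelian case), and Statement 12 as printed for `LP[a,b]`

Lin–Pryadko [LinPryadko2024, §IV.C and App. VIII.B–C]: for a two-block group-algebra code `LP[a,b]` with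
support subgroups `G_a ⊇ supp a`, `G_b ⊇ supp b` and intersection subgroup `N ≡ G_a ∩ G_b` (abelian and
normal in both — automatic for an abelian `G`) of order `c = |N|`, "the subcode of `LP[a,b]` supported in the
double-coset `G_a 1 G_b` is equivalent to a 2BGA code over a group" of order `|G_a 1 G_b|` (Statement 8;
arXiv:2306.16400 chunk p0010 L58–63) whose "square matrices … have the form of Kronecker products,
`A = A₁ ⊗ I_{m_b}`, `B = I_{m_a} ⊗ B₁` … `A₁` and `B₁` have square blocks of size `c` which can be readily seen
to have the form of group algebra matrices `𝕃_N(x_ij) = ℝ_N(x_ij)`, `x_ij ∈ F[N]`. That is, the original 2BGA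
code is an abelian LP code, which can also be seen as an HP code over the ring `R = F[N]`" (proof of Statement
9, chunk p0018 L109–116; the triples `(α, γ, β)`, `α ∈ G_a/N`, `γ ∈ N`, `β ∈ N\G_b`, chunk p0018 L79–83).

This file PROVES the identification for the tree's abelian two-block code `AbelianTwoBlock.css a b`
(`H_X = [A|B]`, `H_Z = [Bᵀ|Aᵀ]`, `A = circulant a`, `B = circulant b` over a finite abelian `G`, coefficients in
`𝔽₂`) in the CONNECTED case `G_a + G_b = G` (the double coset `G_a 1 G_b` is all of `G`; a general pair first
splits along the cosets of `G_a + G_b`, `TwoBlockCosetDecomposition.lean`), with NO new construction: the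
lifted-product side is the tree's `LiftedProduct.xMatrix / zMatrix` (`LiftedProduct.lean`) on matrices of
`N`-circulant blocks, exactly the objects of `QuasiAbelianLPDistance.lean`.

* `AbelianTwoBlock.repIn K L h` — a transversal of `G ⧸ L` inside `K` when `K + L = G` (`repIn_mem`, `mk_repIn`,
  `repIn_sub_repIn_mem_iff`);
* `tripleEquiv Ga Gb h : ((G ⧸ G_b) × (G ⧸ G_a)) × N ≃ G`, `((α, β), γ) ↦ repIn α + repIn β + γ` — Lin–Pryadko's
  "every element of the double coset `G_a 1 G_b` can be written as a triplet" [p0018 L79–83]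
  (`G_a/N ≅ G/G_b` and `N\G_b ≅ G/G_a` when `G_a + G_b = G`); `qubitEquiv` = two copies of it;
* `blk K L h N a α α' : N → 𝔽₂`, `γ ↦ a (repIn α − repIn α' + γ)` — the `F[N]`-entries `x_ij` of `A₁` (resp. `B₁`);
* **`css_HX_submatrix`, `css_HZ_submatrix`**: along these bijections
  `H_X(a,b) = 𝔅([A₁ ⊗ I, −I ⊗ B₁]) = LiftedProduct.xMatrix A₁ B₁` and `H_Z(a,b) = LiftedProduct.zMatrix A₁ B₁`
  LITERALLY (entrywise equalities of `𝔽₂`-matrices), `A₁ = (circulant (blk G_a G_b a α α'))_{α,α' ∈ G/G_b}`,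
  `B₁ = (circulant (blk G_b G_a b β β'))_{β,β' ∈ G/G_a}`;
* `lpCSS` — the quasi-abelian LP code `LP(A₁,B₁)` as a `CSSCode`, `lpCSS_eq_reindex_css`, `cssMinDist_lp_eq`, and by FACT P
  (`CSSEquivalence.lean`) `lpCSS_dX`, `lpCSS_dZ`, `lpCSS_k`, `lpCSS_isCode_iff`: same `d_X`, `d_Z`, `k`, `[[n,k,d]]`;
* `minDist_pcCode_circulant_eq_of_fibration` — the classical ingredient "`A = A₁ ⊗ I_{m_b}`": the code
  `ker 𝕃(a)` on `G` is `|G/G_a|` disjoint copies of `ker 𝔅(A₁)`, so `d(ker 𝕃(a)) = d(ker 𝔅(A₁))`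
  (and the same for the transposes, `flat_blk_neg_eq_transpose`), for any field;
* **`le_cssMinDist_css_of_card_mul_lt`** — Lin–Pryadko's Statement 12 AS PRINTED for abelian `LP[a,b]`:
  `c·(D − 1) < min(d_A^⊥, d_B^⊥) ⟹ D ≤ d`, i.e. `d ≥ ⌈min(d_A^⊥, d_B^⊥)/c⌉`, `d_A^⊥ = d(ker 𝕃(a))`,
  `d_B^⊥ = d(ker ℝ(b))` the distances of the classical group-algebra codes ON `G`, `c = |G_a ∩ G_b|`
  (from `LiftedProduct.le_cssMinDist_of_card_mul_lt`, `QuasiAbelianLPDistance.lean`, whose four block-code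
  distances are identified with `d_A^⊥`, `d_B^⊥` here); `ℕ`-valued forms `le_css_dZ_of_card_mul_lt`,
  `le_css_dX_of_card_mul_lt`.

Scope / not here: non-abelian `G` (Statement 8 in print allows `N` abelian and normal in both support groups,
with a semidirect-product bookkeeping, chunk p0018 L65–100) — TODO(general form); the disconnected case is
`TwoBlockCosetDecomposition.lean` + this file on the root. No named facts, no instances.

## References (locators read on the page)

* [LinPryadko2024] H.-K. Lin, L. P. Pryadko, *Quantum two-block group algebra codes*, Phys. Rev. A 109 (2024)
  022407 = arXiv:2306.16400: Statement 8 (chunk p0010 L58–63) and the HP remark after it (L64–78); App. VIII.B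
  proof of Statement 8 (chunk p0018 L65–100: triples `(α,γ,β)`), App. VIII.C proof of Statement 9 (chunk p0018
  L109–116: `A = A₁ ⊗ I_{m_b}`, `B = I_{m_a} ⊗ B₁`, blocks `𝕃_N(x_ij)`, "the original 2BGA code is an abelian LP
  code"); Statement 12 (chunk p0011 L101–110).
* [KovalevPryadko2013Hyperbicycle] A. A. Kovalev, L. P. Pryadko, PRA 87 (2013) 020304 = arXiv:1212.6703, Thm 5
  (chunk p0011 L83–88).
* [PanteleevKalachev2022LP] P. Panteleev, G. Kalachev, IEEE TIT 68 (2022) 213 = arXiv:2012.04068, §III.D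
  (`LP(A,B)`, chunk p0011 L5–12, L41–44).
-/

namespace Literature.InformationTheory.QuantumCodes

open Matrix

namespace AbelianTwoBlock

variable {G : Type*} [AddCommGroup G]

/-! ### Transversals of `G ⧸ L` inside `K` when `K + L = G` -/

section Transversal

variable (K L : AddSubgroup G)

/-- When `K + L = G`, every coset of `L` meets `K`. [cite: LinPryadko2024, App. VIII.B proof of Statement 8 (arXiv:2306.16400 chunk p0018 L65–70: `G_a = H_a ⋊ N`, `H_a = G_a/N` "sets of cosets")] -/
theorem exists_mem_mk_eq (h : K ⊔ L = ⊤) (q : G ⧸ L) : ∃ x ∈ K, (x : G ⧸ L) = q := by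
  induction q using QuotientAddGroup.induction_on with
  | H g =>
    obtain ⟨y, hy, z, hz, hyz⟩ := AddSubgroup.mem_sup.1 (h ▸ AddSubgroup.mem_top g)
    refine ⟨y, hy, QuotientAddGroup.eq_iff_sub_mem.2 ?_⟩
    rw [← hyz, sub_add_cancel_left]
    exact L.neg_mem hz

/-- A transversal of `G ⧸ L` chosen inside `K` (for `K + L = G`): `repIn q ∈ K` represents the coset `q`.
[cite: LinPryadko2024, §IV.C (arXiv:2306.16400 chunk p0010 L18–20: "`x ∈ 𝒜`, a transversal set of elements") and App. VIII.B (chunk p0018 L79–81: "`𝒜` and `ℬ` … transversal sets of representatives from `G_a/N` and `N\G_b`")] -/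
noncomputable def repIn (h : K ⊔ L = ⊤) (q : G ⧸ L) : G :=
  Classical.choose (exists_mem_mk_eq K L h q)

/-- `repIn q ∈ K`. [cite: LinPryadko2024, App. VIII.B (arXiv:2306.16400 chunk p0018 L79–81)] -/
theorem repIn_mem (h : K ⊔ L = ⊤) (q : G ⧸ L) : repIn K L h q ∈ K :=
  (Classical.choose_spec (exists_mem_mk_eq K L h q)).1

/-- `repIn q` lies in the coset `q`. [cite: LinPryadko2024, App. VIII.B (arXiv:2306.16400 chunk p0018 L79–81)] -/
theorem mk_repIn (h : K ⊔ L = ⊤) (q : G ⧸ L) : ((repIn K L h q : G) : G ⧸ L) = q :=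
  (Classical.choose_spec (exists_mem_mk_eq K L h q)).2

/-- Two representatives differ by an element of `L` only if they are equal. [cite: LinPryadko2024, App. VIII.B (arXiv:2306.16400 chunk p0018 L79–83)] -/
theorem repIn_sub_repIn_mem_iff (h : K ⊔ L = ⊤) (q q' : G ⧸ L) : repIn K L h q - repIn K L h q' ∈ L ↔ q = q' := by
  rw [← QuotientAddGroup.eq_iff_sub_mem (N := L), mk_repIn, mk_repIn]

end Transversal

/-! ### The triple decomposition `G ≃ (G/G_b × G/G_a) × N`, `N = G_a ∩ G_b`, for `G_a + G_b = G` -/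

section Triple

variable (Ga Gb : AddSubgroup G)

/-- `G_a + G_b = G_b + G_a`. [folklore] -/
private theorem sup_comm_eq_top (h : Ga ⊔ Gb = ⊤) : Gb ⊔ Ga = ⊤ := by
  rw [sup_comm]; exact h

/-- Lin–Pryadko's triples: `((α, β), γ) ↦ repIn α + repIn β + γ` with `repIn α ∈ G_a` a representative of
`α ∈ G/G_b ≅ G_a/N`, `repIn β ∈ G_b` a representative of `β ∈ G/G_a ≅ N\G_b`, `γ ∈ N = G_a ∩ G_b`.
[cite: LinPryadko2024, App. VIII.B proof of Statement 8 (arXiv:2306.16400 chunk p0018 L79–83: "any element of the double coset `G_a 1 G_b` can be written as a triplet, `(α,γ,β)`")] -/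
noncomputable def tripleFun (h : Ga ⊔ Gb = ⊤) : ((G ⧸ Gb) × (G ⧸ Ga)) × ↥(Ga ⊓ Gb) → G :=
  fun p => repIn Ga Gb h p.1.1 + repIn Gb Ga (sup_comm_eq_top Ga Gb h) p.1.2 + (p.2 : G)

/-- Unfolding `tripleFun`. [cite: LinPryadko2024, App. VIII.B (arXiv:2306.16400 chunk p0018 L79–83)] -/
theorem tripleFun_apply (h : Ga ⊔ Gb = ⊤) (α : G ⧸ Gb) (β : G ⧸ Ga) (γ : ↥(Ga ⊓ Gb)) :
    tripleFun Ga Gb h ((α, β), γ) = repIn Ga Gb h α + repIn Gb Ga (sup_comm_eq_top Ga Gb h) β + (γ : G) := rfl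

/-- The difference of two triples lies in `G_a` iff their `G/G_a`-components agree (the block structure of
`B = I ⊗ B₁`). [cite: LinPryadko2024, App. VIII.C (arXiv:2306.16400 chunk p0018 L109–112: `A = A₁ ⊗ I_{m_b}`, `B = I_{m_a} ⊗ B₁`)] -/
theorem tripleFun_sub_tripleFun_mem_left_iff (h : Ga ⊔ Gb = ⊤) (α α' : G ⧸ Gb) (β β' : G ⧸ Ga)
    (γ γ' : ↥(Ga ⊓ Gb)) :
    tripleFun Ga Gb h ((α, β), γ) - tripleFun Ga Gb h ((α', β'), γ') ∈ Ga ↔ β = β' := by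
  rw [← repIn_sub_repIn_mem_iff Gb Ga (sup_comm_eq_top Ga Gb h) β β']
  have hx : repIn Ga Gb h α - repIn Ga Gb h α' + ((γ : G) - γ') ∈ Ga :=
    Ga.add_mem (Ga.sub_mem (repIn_mem _ _ h α) (repIn_mem _ _ h α')) (Ga.sub_mem γ.2.1 γ'.2.1)
  have key : tripleFun Ga Gb h ((α, β), γ) - tripleFun Ga Gb h ((α', β'), γ') =
      (repIn Ga Gb h α - repIn Ga Gb h α' + ((γ : G) - γ')) +
        (repIn Gb Ga (sup_comm_eq_top Ga Gb h) β - repIn Gb Ga (sup_comm_eq_top Ga Gb h) β') := by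
    simp only [tripleFun_apply]; abel
  rw [key]
  exact ⟨fun hm => by simpa using Ga.sub_mem hm hx, fun hm => Ga.add_mem hx hm⟩

/-- The difference of two triples lies in `G_b` iff their `G/G_b`-components agree (the block structure of
`A = A₁ ⊗ I`). [cite: LinPryadko2024, App. VIII.C (arXiv:2306.16400 chunk p0018 L109–112)] -/
theorem tripleFun_sub_tripleFun_mem_right_iff (h : Ga ⊔ Gb = ⊤) (α α' : G ⧸ Gb) (β β' : G ⧸ Ga)
    (γ γ' : ↥(Ga ⊓ Gb)) :
    tripleFun Ga Gb h ((α, β), γ) - tripleFun Ga Gb h ((α', β'), γ') ∈ Gb ↔ α = α' := by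
  rw [← repIn_sub_repIn_mem_iff Ga Gb h α α']
  have hx : repIn Gb Ga (sup_comm_eq_top Ga Gb h) β - repIn Gb Ga (sup_comm_eq_top Ga Gb h) β' + ((γ : G) - γ') ∈ Gb :=
    Gb.add_mem (Gb.sub_mem (repIn_mem _ _ _ β) (repIn_mem _ _ _ β')) (Gb.sub_mem γ.2.2 γ'.2.2)
  have key : tripleFun Ga Gb h ((α, β), γ) - tripleFun Ga Gb h ((α', β'), γ') =
      (repIn Gb Ga (sup_comm_eq_top Ga Gb h) β - repIn Gb Ga (sup_comm_eq_top Ga Gb h) β' + ((γ : G) - γ')) +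
        (repIn Ga Gb h α - repIn Ga Gb h α') := by
    simp only [tripleFun_apply]; abel
  rw [key]
  exact ⟨fun hm => by simpa using Gb.sub_mem hm hx, fun hm => Gb.add_mem hx hm⟩

/-- The triple map is a bijection onto `G` (here: onto the connected double coset `G_a 1 G_b = G`).
[cite: LinPryadko2024, App. VIII.B proof of Statement 8 (arXiv:2306.16400 chunk p0018 L79–83)] -/
theorem tripleFun_bijective (h : Ga ⊔ Gb = ⊤) : Function.Bijective (tripleFun Ga Gb h) := by
  refine ⟨?_, fun g => ?_⟩
  · rintro ⟨⟨α, β⟩, γ⟩ ⟨⟨α', β'⟩, γ'⟩ hφ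
    have hβ : β = β' := (tripleFun_sub_tripleFun_mem_left_iff Ga Gb h α α' β β' γ γ').1
      (by rw [hφ, sub_self]; exact Ga.zero_mem)
    have hα : α = α' := (tripleFun_sub_tripleFun_mem_right_iff Ga Gb h α α' β β' γ γ').1
      (by rw [hφ, sub_self]; exact Gb.zero_mem)
    subst hα hβ
    simp only [tripleFun_apply, add_right_inj, SetLike.coe_eq_coe] at hφ
    rw [hφ]
  · -- surjectivity: `α = [g]`, `β = [g]`, `γ = g − repIn α − repIn β ∈ G_a ∩ G_b`
    have hα : g - repIn Ga Gb h (g : G ⧸ Gb) ∈ Gb := by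
      rw [← QuotientAddGroup.eq_iff_sub_mem (N := Gb), mk_repIn]
    have hβ : g - repIn Gb Ga (sup_comm_eq_top Ga Gb h) (g : G ⧸ Ga) ∈ Ga := by
      rw [← QuotientAddGroup.eq_iff_sub_mem (N := Ga), mk_repIn]
    have hγa : g - repIn Ga Gb h (g : G ⧸ Gb) - repIn Gb Ga (sup_comm_eq_top Ga Gb h) (g : G ⧸ Ga) ∈ Ga := by
      have := Ga.sub_mem hβ (repIn_mem Ga Gb h (g : G ⧸ Gb))
      convert this using 1; abel
    have hγb : g - repIn Ga Gb h (g : G ⧸ Gb) - repIn Gb Ga (sup_comm_eq_top Ga Gb h) (g : G ⧸ Ga) ∈ Gb :=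
      Gb.sub_mem hα (repIn_mem Gb Ga _ (g : G ⧸ Ga))
    refine ⟨(((g : G ⧸ Gb), (g : G ⧸ Ga)), ⟨_, hγa, hγb⟩), ?_⟩
    simp only [tripleFun_apply]
    abel

/-- **The triple decomposition** `((G/G_b) × (G/G_a)) × N ≃ G` of a connected abelian two-block index set.
[cite: LinPryadko2024, Statement 8 and App. VIII.B (arXiv:2306.16400 chunk p0010 L58–63, p0018 L79–83)] -/
noncomputable def tripleEquiv (h : Ga ⊔ Gb = ⊤) : ((G ⧸ Gb) × (G ⧸ Ga)) × ↥(Ga ⊓ Gb) ≃ G :=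
  Equiv.ofBijective _ (tripleFun_bijective Ga Gb h)

/-- Unfolding `tripleEquiv`. [cite: LinPryadko2024, App. VIII.B (arXiv:2306.16400 chunk p0018 L79–83)] -/
theorem tripleEquiv_apply (h : Ga ⊔ Gb = ⊤) (p : ((G ⧸ Gb) × (G ⧸ Ga)) × ↥(Ga ⊓ Gb)) :
    tripleEquiv Ga Gb h p = tripleFun Ga Gb h p := rfl

/-- The qubit bijection: both blocks of `G ⊕ G` decomposed by triples, matching the LP qubit index
`((n_A × m_B) ⊕ (m_A × n_B)) × N`. [cite: LinPryadko2024, App. VIII.C (arXiv:2306.16400 chunk p0018 L109–116)] -/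
noncomputable def qubitEquiv (h : Ga ⊔ Gb = ⊤) :
    ((((G ⧸ Gb) × (G ⧸ Ga)) ⊕ ((G ⧸ Gb) × (G ⧸ Ga))) × ↥(Ga ⊓ Gb)) ≃ G ⊕ G :=
  (Equiv.sumProdDistrib _ _ _).trans (Equiv.sumCongr (tripleEquiv Ga Gb h) (tripleEquiv Ga Gb h))

/-- `qubitEquiv (inl p, γ) = inl (triple (p, γ))`. [cite: LinPryadko2024, App. VIII.C (arXiv:2306.16400 chunk p0018 L109–116)] -/
@[simp] theorem qubitEquiv_inl (h : Ga ⊔ Gb = ⊤) (p : (G ⧸ Gb) × (G ⧸ Ga)) (γ : ↥(Ga ⊓ Gb)) :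
    qubitEquiv Ga Gb h (Sum.inl p, γ) = Sum.inl (tripleFun Ga Gb h (p, γ)) := rfl

/-- `qubitEquiv (inr p, γ) = inr (triple (p, γ))`. [cite: LinPryadko2024, App. VIII.C (arXiv:2306.16400 chunk p0018 L109–116)] -/
@[simp] theorem qubitEquiv_inr (h : Ga ⊔ Gb = ⊤) (p : (G ⧸ Gb) × (G ⧸ Ga)) (γ : ↥(Ga ⊓ Gb)) :
    qubitEquiv Ga Gb h (Sum.inr p, γ) = Sum.inr (tripleFun Ga Gb h (p, γ)) := rfl

end Triple

/-! ### The `F[N]`-blocks `x_ij` of `A₁`, `B₁` -/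

section Blocks

variable {F : Type*} (K L : AddSubgroup G) (N : AddSubgroup G)

/-- The `F[N]`-entry of `A₁` at `(α, α')`: the coefficient function `γ ↦ a (repIn α − repIn α' + γ)` on `N`
(so that `circulant (blk … α α')` is the `(α, α')` block `𝕃_N(x_{αα'})` of `A₁`).
[cite: LinPryadko2024, App. VIII.C (arXiv:2306.16400 chunk p0018 L112–114: "`A₁` and `B₁` have square blocks of size `c` … group algebra matrices `𝕃_N(x_ij) = ℝ_N(x_ij)`, `x_ij ∈ F[N]`")] -/
noncomputable def blk (h : K ⊔ L = ⊤) (a : G → F) (q q' : G ⧸ L) : ↥N → F :=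
  fun γ => a (repIn K L h q - repIn K L h q' + (γ : G))

/-- Unfolding `blk`. [cite: LinPryadko2024, App. VIII.C (arXiv:2306.16400 chunk p0018 L112–114)] -/
theorem blk_apply (h : K ⊔ L = ⊤) (a : G → F) (q q' : G ⧸ L) (γ : ↥N) :
    blk K L N h a q q' γ = a (repIn K L h q - repIn K L h q' + (γ : G)) := rfl

/-- The blocks of the REVERSED coefficient function `g ↦ a(−g)` are the block-transposes: `𝔅(A₁)ᵀ` is again of
this form (used for the transposed-code distances `d̃`). [cite: PanteleevKalachev2022LP, §III.D (arXiv:2012.04068 chunk p0011 L3: `𝔅(M*) = 𝔅(M)ᵀ`)] -/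
theorem flat_blk_neg_eq_transpose (h : K ⊔ L = ⊤) (a : G → F) :
    LiftedProduct.flat (blk K L N h (fun g => a (-g))) = (LiftedProduct.flat (blk K L N h a))ᵀ := by
  rw [← LiftedProduct.flat_reverse_eq_transpose]
  congr 1
  funext q q' γ
  simp only [blk_apply, AddSubgroup.coe_neg]
  congr 1
  abel

end Blocks

/-! ### `d(ker 𝕃(a)) = d(ker 𝔅(A₁))`: the code of `A = A₁ ⊗ I` is `|G/G_a|` copies of the code of `A₁` -/

section Fibration

variable {F : Type*} [Field F] [DecidableEq F]
variable [Fintype G] [DecidableEq G]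
variable {X B : Type*} [Fintype X] [Fintype B] [DecidableEq X] [DecidableEq B]
variable (N K : AddSubgroup G) [DecidablePred (· ∈ N)]
variable (φ : (X × B) × ↥N ≃ G) (r : X → G) (s : B → G)

omit [DecidableEq F] [Fintype G] [DecidableEq G] [Fintype X] [Fintype B] [DecidableEq X] [DecidablePred (· ∈ N)] in
/-- Entries of `𝕃(a) = circulant a` in fibred coordinates `g = r x + s b + γ` (`r x ∈ K ⊇ N ⊇ supp`-data,
`s b − s b' ∈ K ⇒ b = b'`, `supp a ⊆ K`): `[b = b'] · a (r x − r x' + (γ − γ'))` — i.e. `A = A₁ ⊗ I`.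
[cite: LinPryadko2024, App. VIII.C (arXiv:2306.16400 chunk p0018 L109–112: `A = A₁ ⊗ I_{m_b}`)] -/
theorem circulant_fibred_apply (hφ : ∀ x b γ, φ ((x, b), γ) = r x + s b + (γ : G)) (hr : ∀ x, r x ∈ K)
    (hN : N ≤ K) (hs : ∀ b b', s b - s b' ∈ K → b = b') (a : G → F) (ha : ∀ g, g ∉ K → a g = 0)
    (x x' : X) (b b' : B) (γ γ' : ↥N) :
    circulant a (φ ((x, b), γ)) (φ ((x', b'), γ')) =
      if b = b' then a (r x - r x' + ((γ - γ' : ↥N) : G)) else 0 := by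
  rw [circulant_apply, hφ, hφ]
  by_cases hb : b = b'
  · subst hb
    rw [if_pos rfl, AddSubgroup.coe_sub]
    congr 1
    abel
  · rw [if_neg hb]
    refine ha _ fun hmem => hb (hs b b' ?_)
    have h1 : r x - r x' + ((γ : G) - γ') ∈ K :=
      K.add_mem (K.sub_mem (hr x) (hr x')) (K.sub_mem (hN γ.2) (hN γ'.2))
    have key : s b - s b' = (r x + s b + (γ : G) - (r x' + s b' + (γ' : G))) - (r x - r x' + ((γ : G) - γ')) := by
      abel
    rw [key]
    exact K.sub_mem hmem h1

omit [DecidableEq G] [DecidableEq X] in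
/-- **`d(ker 𝕃(a)) = d(ker 𝔅(A₁))`**: with `A = A₁ ⊗ I_{m_b}` in fibred coordinates, the classical code
`ker A` on `G` is the direct sum of `m_b = |B|` copies of `ker 𝔅(A₁)` (one per fibre `b`), so the two minimum
distances agree (restriction to a fibre / extension by zero). Any field.
[cite: LinPryadko2024, App. VIII.C (arXiv:2306.16400 chunk p0018 L109–116) and §IV.C (chunk p0010 L72–75: "these parameters remain the same")] -/
theorem minDist_pcCode_circulant_eq_of_fibration [Nonempty B]
    (hφ : ∀ x b γ, φ ((x, b), γ) = r x + s b + (γ : G)) (hr : ∀ x, r x ∈ K) (hN : N ≤ K)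
    (hs : ∀ b b', s b - s b' ∈ K → b = b') (a : G → F) (ha : ∀ g, g ∉ K → a g = 0) :
    Coding.minDist (pcCode (circulant a)) =
      Coding.minDist (pcCode (LiftedProduct.flat (fun x x' : X => fun γ : ↥N => a (r x - r x' + (γ : G))))) := by
  have hent := circulant_fibred_apply N K φ r s hφ hr hN hs a ha
  -- the circulant acting on a vector, read in fibred coordinates
  have hmul : ∀ (v : G → F) (x : X) (b : B) (γ : ↥N), (circulant a *ᵥ v) (φ ((x, b), γ)) =
      ∑ x' : X, ∑ γ' : ↥N, a (r x - r x' + ((γ - γ' : ↥N) : G)) * v (φ ((x', b), γ')) := by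
    intro v x b γ
    rw [mulVec, dotProduct, ← Equiv.sum_comp φ, Fintype.sum_prod_type, Fintype.sum_prod_type]
    refine Finset.sum_congr rfl fun x' _ => ?_
    rw [Finset.sum_eq_single b]
    · exact Finset.sum_congr rfl fun γ' _ => by rw [hent, if_pos rfl]
    · intro b' _ hb'
      exact Finset.sum_eq_zero fun γ' _ => by rw [hent, if_neg (Ne.symm hb'), zero_mul]
    · intro hb; exact absurd (Finset.mem_univ b) hb
  have hflat : ∀ (y : X × ↥N → F) (x : X) (γ : ↥N),
      (LiftedProduct.flat (fun x x' : X => fun γ : ↥N => a (r x - r x' + (γ : G))) *ᵥ y) (x, γ) =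
        ∑ x' : X, ∑ γ' : ↥N, a (r x - r x' + ((γ - γ' : ↥N) : G)) * y (x', γ') := by
    intro y x γ
    rw [mulVec, dotProduct, Fintype.sum_prod_type]
    rfl
  refine le_antisymm (Coding.le_minDist_iff.2 fun y hy hy0 => ?_) (Coding.le_minDist_iff.2 fun v hv hv0 => ?_)
  · -- extension by zero of a codeword of `ker 𝔅(A₁)` on the fibre `b₀`
    obtain ⟨b₀⟩ := ‹Nonempty B›
    set v : G → F := fun g => if (φ.symm g).1.2 = b₀ then y ((φ.symm g).1.1, (φ.symm g).2) else 0 with hvdef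
    have hvφ : ∀ x b γ, v (φ ((x, b), γ)) = if b = b₀ then y (x, γ) else 0 := by
      intro x b γ; simp [hvdef]
    have hvmem : v ∈ pcCode (circulant a) := by
      rw [mem_pcCode_iff]
      funext g
      obtain ⟨⟨⟨x, b⟩, γ⟩, rfl⟩ := φ.surjective g
      rw [hmul, Pi.zero_apply]
      by_cases hb : b = b₀
      · subst hb
        have := congrFun ((mem_pcCode_iff _ _).1 hy) (x, γ)
        rw [hflat, Pi.zero_apply] at this
        rw [← this]
        exact Finset.sum_congr rfl fun x' _ => Finset.sum_congr rfl fun γ' _ => by rw [hvφ, if_pos rfl]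
      · exact Finset.sum_eq_zero fun x' _ => Finset.sum_eq_zero fun γ' _ => by rw [hvφ, if_neg hb, mul_zero]
    have hv0 : v ≠ 0 := by
      intro h0
      apply hy0
      funext ⟨x, γ⟩
      have := congrFun h0 (φ ((x, b₀), γ))
      rwa [hvφ, if_pos rfl] at this
    refine (Coding.minDist_le_hammingNorm hvmem hv0).trans ?_
    -- `wt v ≤ wt y`: the support of `v` injects into the support of `y`
    unfold hammingNorm
    exact_mod_cast Finset.card_le_card_of_injOn (fun g => ((φ.symm g).1.1, (φ.symm g).2))
      (fun g hg => by
        simp only [Finset.coe_filter, Finset.mem_univ, true_and, Set.mem_setOf_eq] at hg ⊢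
        obtain ⟨⟨⟨x, b⟩, γ⟩, rfl⟩ := φ.surjective g
        rw [hvφ] at hg
        by_cases hb : b = b₀
        · rw [if_pos hb] at hg; simpa using hg
        · rw [if_neg hb] at hg; exact absurd rfl hg)
      (fun g hg g' hg' hgg' => by
        simp only [Finset.coe_filter, Finset.mem_univ, true_and, Set.mem_setOf_eq] at hg hg'
        obtain ⟨⟨⟨x, b⟩, γ⟩, rfl⟩ := φ.surjective g
        obtain ⟨⟨⟨x', b'⟩, γ'⟩, rfl⟩ := φ.surjective g'
        rw [hvφ] at hg hg'
        have hb : b = b₀ := by by_contra hb; rw [if_neg hb] at hg; exact hg rfl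
        have hb' : b' = b₀ := by by_contra hb'; rw [if_neg hb'] at hg'; exact hg' rfl
        subst hb hb'
        simp only [Equiv.symm_apply_apply, Prod.mk.injEq] at hgg'
        rw [hgg'.1, hgg'.2])
  · -- restriction of a codeword of `ker A` to a fibre through its support
    obtain ⟨g₀, hg₀⟩ := Function.ne_iff.1 hv0
    obtain ⟨⟨⟨x₀, b₀⟩, γ₀⟩, rfl⟩ := φ.surjective g₀
    set y : X × ↥N → F := fun p => v (φ ((p.1, b₀), p.2)) with hydef
    have hymem : y ∈ pcCode (LiftedProduct.flat (fun x x' : X => fun γ : ↥N => a (r x - r x' + (γ : G)))) := by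
      rw [mem_pcCode_iff]
      funext ⟨x, γ⟩
      rw [hflat, Pi.zero_apply]
      have := congrFun ((mem_pcCode_iff _ _).1 hv) (φ ((x, b₀), γ))
      rwa [hmul, Pi.zero_apply] at this
    have hy0 : y ≠ 0 := fun h0 => hg₀ (by simpa [hydef] using congrFun h0 (x₀, γ₀))
    refine (Coding.minDist_le_hammingNorm hymem hy0).trans ?_
    unfold hammingNorm
    exact_mod_cast Finset.card_le_card_of_injOn (fun p : X × ↥N => φ ((p.1, b₀), p.2))
      (fun p hp => by simpa [hydef] using hp)
      (fun p _ p' _ hpp' => by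
        have := φ.injective hpp'
        simp only [Prod.mk.injEq] at this
        exact Prod.ext this.1.1 this.2)

end Fibration

/-! ### The identification `css a b ≅ LP(A₁, B₁)` -/

section Identification

variable [Fintype G] [DecidableEq G] (Ga Gb : AddSubgroup G)
variable [DecidablePred (· ∈ Ga)] [DecidablePred (· ∈ Gb)] [DecidablePred (· ∈ Ga ⊓ Gb)]

/-- The block matrix `A₁ = (𝕃_N(x_{αα'}))` over `F[N]`, `N = G_a ∩ G_b`, rows/columns `G/G_b ≅ G_a/N`.
(abbreviation) [cite: LinPryadko2024, App. VIII.C (arXiv:2306.16400 chunk p0018 L109–114)] -/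
noncomputable abbrev blocksA (h : Ga ⊔ Gb = ⊤) (a : G → ZMod 2) :
    Matrix (G ⧸ Gb) (G ⧸ Gb) (Matrix ↥(Ga ⊓ Gb) ↥(Ga ⊓ Gb) (ZMod 2)) :=
  fun α α' => circulant (blk Ga Gb (Ga ⊓ Gb) h a α α')

/-- The block matrix `B₁ = (ℝ_N(x_{ββ'}))` over `F[N]`, rows/columns `G/G_a ≅ N\G_b`.
(abbreviation) [cite: LinPryadko2024, App. VIII.C (arXiv:2306.16400 chunk p0018 L109–114)] -/
noncomputable abbrev blocksB (h : Ga ⊔ Gb = ⊤) (b : G → ZMod 2) :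
    Matrix (G ⧸ Ga) (G ⧸ Ga) (Matrix ↥(Ga ⊓ Gb) ↥(Ga ⊓ Gb) (ZMod 2)) :=
  fun β β' => circulant (blk Gb Ga (Ga ⊓ Gb) (sup_comm_eq_top Ga Gb h) b β β')

/-- In `𝔽₂`, `−x = x`. [folklore] -/
private theorem neg_eq_self_zmod2 (x : ZMod 2) : -x = x := by
  fin_cases x <;> decide

/-- **`H_X(a,b) = 𝔅([A₁ ⊗ I, −I ⊗ B₁]) = xMatrix A₁ B₁`** along the triple bijections (supports in `G_a`, `G_b`,
connected case `G_a + G_b = G`). [cite: LinPryadko2024, Statement 8 and App. VIII.C (arXiv:2306.16400 chunk p0010 L58–63; p0018 L109–116: "the original 2BGA code is an abelian LP code")] -/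
theorem css_HX_submatrix (h : Ga ⊔ Gb = ⊤) (a b : G → ZMod 2) (ha : ∀ g, g ∉ Ga → a g = 0)
    (hb : ∀ g, g ∉ Gb → b g = 0) :
    (css a b).HX.submatrix (tripleEquiv Ga Gb h) (qubitEquiv Ga Gb h) =
      LiftedProduct.xMatrix (blocksA Ga Gb h a) (blocksB Ga Gb h b) := by
  have hA := circulant_fibred_apply (Ga ⊓ Gb) Ga (tripleEquiv Ga Gb h) (repIn Ga Gb h)
    (repIn Gb Ga (sup_comm_eq_top Ga Gb h)) (fun _ _ _ => rfl) (repIn_mem Ga Gb h) inf_le_left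
    (fun β β' => (repIn_sub_repIn_mem_iff Gb Ga _ β β').1) a ha
  have hB := circulant_fibred_apply (Ga ⊓ Gb) Gb
    ((Equiv.prodCongr (Equiv.prodComm _ _) (Equiv.refl _)).trans (tripleEquiv Ga Gb h))
    (repIn Gb Ga (sup_comm_eq_top Ga Gb h)) (repIn Ga Gb h)
    (fun β α γ => by simp [tripleEquiv_apply, tripleFun_apply, add_comm])
    (repIn_mem Gb Ga _) inf_le_right (fun α α' => (repIn_sub_repIn_mem_iff Ga Gb h α α').1) b hb
  rw [LiftedProduct.xMatrix_eq_of_xEntry]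
  ext ⟨⟨α, β⟩, γ⟩ ⟨c, γ'⟩
  rcases c with ⟨α', β'⟩ | ⟨α', β'⟩
  · rw [submatrix_apply, qubitEquiv_inl, css_HX, HX_def, fromCols_apply_inl, of_apply, LiftedProduct.xEntry,
      ← tripleEquiv_apply, hA]
    rfl
  · rw [submatrix_apply, qubitEquiv_inr, css_HX, HX_def, fromCols_apply_inr, of_apply, LiftedProduct.xEntry,
      neg_eq_self_zmod2]
    have := hB β β' α α' γ γ'
    simp only [Equiv.trans_apply, Equiv.prodCongr_apply, Equiv.prodComm_apply, Prod.map_apply, Prod.swap_prod_mk,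
      Equiv.refl_apply] at this
    rw [← tripleEquiv_apply, this]
    rfl

/-- **`H_Z(a,b) = 𝔅([I ⊗ B₁*, A₁* ⊗ I]) = zMatrix A₁ B₁`** along the same bijections.
[cite: LinPryadko2024, Statement 8 and App. VIII.C (arXiv:2306.16400 chunk p0010 L58–63; p0018 L109–116)] -/
theorem css_HZ_submatrix (h : Ga ⊔ Gb = ⊤) (a b : G → ZMod 2) (ha : ∀ g, g ∉ Ga → a g = 0)
    (hb : ∀ g, g ∉ Gb → b g = 0) :
    (css a b).HZ.submatrix (tripleEquiv Ga Gb h) (qubitEquiv Ga Gb h) =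
      LiftedProduct.zMatrix (blocksA Ga Gb h a) (blocksB Ga Gb h b) := by
  have hA := circulant_fibred_apply (Ga ⊓ Gb) Ga (tripleEquiv Ga Gb h) (repIn Ga Gb h)
    (repIn Gb Ga (sup_comm_eq_top Ga Gb h)) (fun _ _ _ => rfl) (repIn_mem Ga Gb h) inf_le_left
    (fun β β' => (repIn_sub_repIn_mem_iff Gb Ga _ β β').1) a ha
  have hB := circulant_fibred_apply (Ga ⊓ Gb) Gb
    ((Equiv.prodCongr (Equiv.prodComm _ _) (Equiv.refl _)).trans (tripleEquiv Ga Gb h))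
    (repIn Gb Ga (sup_comm_eq_top Ga Gb h)) (repIn Ga Gb h)
    (fun β α γ => by simp [tripleEquiv_apply, tripleFun_apply, add_comm])
    (repIn_mem Gb Ga _) inf_le_right (fun α α' => (repIn_sub_repIn_mem_iff Ga Gb h α α').1) b hb
  rw [LiftedProduct.zMatrix_eq_of_zEntry]
  ext ⟨⟨α, β⟩, γ⟩ ⟨c, γ'⟩
  rcases c with ⟨α', β'⟩ | ⟨α', β'⟩
  · rw [submatrix_apply, qubitEquiv_inl, css_HZ, HZ_def, fromCols_apply_inl, transpose_apply, of_apply,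
      LiftedProduct.zEntry]
    have := hB β' β α' α γ' γ
    simp only [Equiv.trans_apply, Equiv.prodCongr_apply, Equiv.prodComm_apply, Prod.map_apply, Prod.swap_prod_mk,
      Equiv.refl_apply] at this
    rw [← tripleEquiv_apply, this]
    by_cases hα : α = α'
    · subst hα; simp [circulant_apply, blk_apply]
    · rw [if_neg (Ne.symm hα), if_neg hα]
  · rw [submatrix_apply, qubitEquiv_inr, css_HZ, HZ_def, fromCols_apply_inr, transpose_apply, of_apply,
      LiftedProduct.zEntry, ← tripleEquiv_apply, hA]
    by_cases hβ : β = β'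
    · subst hβ; simp [circulant_apply, blk_apply]
    · rw [if_neg (Ne.symm hβ), if_neg hβ]

/-- **The quasi-abelian lifted-product code `LP(A₁, B₁)` over `𝔽₂[N]`** to which `css a b` is equivalent, as a
`CSSCode` (check matrices `LiftedProduct.xMatrix/zMatrix A₁ B₁`; commutation inherited from `css a b`).
[cite: LinPryadko2024, Statement 8 and App. VIII.C (arXiv:2306.16400 chunk p0010 L58–63; p0018 L109–116)] -/
noncomputable def lpCSS (h : Ga ⊔ Gb = ⊤) (a b : G → ZMod 2) (ha : ∀ g, g ∉ Ga → a g = 0)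
    (hb : ∀ g, g ∉ Gb → b g = 0) :
    CSSCode (((G ⧸ Gb) × (G ⧸ Ga)) × ↥(Ga ⊓ Gb)) (((G ⧸ Gb) × (G ⧸ Ga)) × ↥(Ga ⊓ Gb))
      ((((G ⧸ Gb) × (G ⧸ Ga)) ⊕ ((G ⧸ Gb) × (G ⧸ Ga))) × ↥(Ga ⊓ Gb)) where
  HX := LiftedProduct.xMatrix (blocksA Ga Gb h a) (blocksB Ga Gb h b)
  HZ := LiftedProduct.zMatrix (blocksA Ga Gb h a) (blocksB Ga Gb h b)
  comm := by
    rw [← css_HX_submatrix Ga Gb h a b ha hb, ← css_HZ_submatrix Ga Gb h a b ha hb, transpose_submatrix,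
      submatrix_mul_equiv, (css a b).comm, submatrix_zero, Pi.zero_def, Pi.zero_def]

/-- `(lpCSS …).HX = xMatrix A₁ B₁`. [cite: LinPryadko2024, App. VIII.C (arXiv:2306.16400 chunk p0018 L109–116)] -/
@[simp] theorem lpCSS_HX (h : Ga ⊔ Gb = ⊤) (a b : G → ZMod 2) (ha : ∀ g, g ∉ Ga → a g = 0)
    (hb : ∀ g, g ∉ Gb → b g = 0) :
    (lpCSS Ga Gb h a b ha hb).HX = LiftedProduct.xMatrix (blocksA Ga Gb h a) (blocksB Ga Gb h b) := rfl

/-- `(lpCSS …).HZ = zMatrix A₁ B₁`. [cite: LinPryadko2024, App. VIII.C (arXiv:2306.16400 chunk p0018 L109–116)] -/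
@[simp] theorem lpCSS_HZ (h : Ga ⊔ Gb = ⊤) (a b : G → ZMod 2) (ha : ∀ g, g ∉ Ga → a g = 0)
    (hb : ∀ g, g ∉ Gb → b g = 0) :
    (lpCSS Ga Gb h a b ha hb).HZ = LiftedProduct.zMatrix (blocksA Ga Gb h a) (blocksB Ga Gb h b) := rfl

/-- **`css a b` IS `LP(A₁,B₁)` re-indexed** ("the original 2BGA code is an abelian LP code").
[cite: LinPryadko2024, Statement 8 and App. VIII.C (arXiv:2306.16400 chunk p0010 L58–63; p0018 L109–116)] -/
theorem lpCSS_eq_reindex_css (h : Ga ⊔ Gb = ⊤) (a b : G → ZMod 2) (ha : ∀ g, g ∉ Ga → a g = 0)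
    (hb : ∀ g, g ∉ Gb → b g = 0) :
    lpCSS Ga Gb h a b ha hb =
      (css a b).reindex (tripleEquiv Ga Gb h).symm (tripleEquiv Ga Gb h).symm (qubitEquiv Ga Gb h).symm :=
  CSSCode.eq_reindex_of_submatrix (css_HX_submatrix Ga Gb h a b ha hb).symm (css_HZ_submatrix Ga Gb h a b ha hb).symm

/-- Same `Z`-distance. [cite: LinPryadko2024, §IV.B Thm 6 (code equivalence preserves parameters) and Statement 8 (arXiv:2306.16400 chunk p0009 L66–74, p0010 L58–63)] -/
theorem lpCSS_dZ (h : Ga ⊔ Gb = ⊤) (a b : G → ZMod 2) (ha : ∀ g, g ∉ Ga → a g = 0)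
    (hb : ∀ g, g ∉ Gb → b g = 0) : (lpCSS Ga Gb h a b ha hb).dZ = (css a b).dZ :=
  CSSCode.dZ_eq_of_submatrix (css_HX_submatrix Ga Gb h a b ha hb).symm (css_HZ_submatrix Ga Gb h a b ha hb).symm

/-- Same `X`-distance. [cite: LinPryadko2024, §IV.B Thm 6 and Statement 8 (arXiv:2306.16400 chunk p0009 L66–74, p0010 L58–63)] -/
theorem lpCSS_dX (h : Ga ⊔ Gb = ⊤) (a b : G → ZMod 2) (ha : ∀ g, g ∉ Ga → a g = 0)
    (hb : ∀ g, g ∉ Gb → b g = 0) : (lpCSS Ga Gb h a b ha hb).dX = (css a b).dX :=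
  CSSCode.dX_eq_of_submatrix (css_HX_submatrix Ga Gb h a b ha hb).symm (css_HZ_submatrix Ga Gb h a b ha hb).symm

/-- Same number of logical qubits. [cite: LinPryadko2024, §IV.B Thm 6 and Statement 8 (arXiv:2306.16400 chunk p0009 L66–74, p0010 L58–63)] -/
theorem lpCSS_k (h : Ga ⊔ Gb = ⊤) (a b : G → ZMod 2) (ha : ∀ g, g ∉ Ga → a g = 0)
    (hb : ∀ g, g ∉ Gb → b g = 0) : (lpCSS Ga Gb h a b ha hb).k = (css a b).k :=
  CSSCode.k_eq_of_submatrix (css_HX_submatrix Ga Gb h a b ha hb).symm (css_HZ_submatrix Ga Gb h a b ha hb).symm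

/-- Same `[[n, k, d]]`. [cite: LinPryadko2024, §IV.B Thm 6 and Statement 8 (arXiv:2306.16400 chunk p0009 L66–91, p0010 L58–63)] -/
theorem lpCSS_isCode_iff (h : Ga ⊔ Gb = ⊤) (a b : G → ZMod 2) (ha : ∀ g, g ∉ Ga → a g = 0)
    (hb : ∀ g, g ∉ Gb → b g = 0) (n k d : ℕ) :
    (lpCSS Ga Gb h a b ha hb).IsCode n k d ↔ (css a b).IsCode n k d :=
  CSSCode.isCode_iff_of_submatrix (css_HX_submatrix Ga Gb h a b ha hb).symm
    (css_HZ_submatrix Ga Gb h a b ha hb).symm n k d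

/-- Same Tillich–Zémor minimum distance `cssMinDist`. [cite: LinPryadko2024, §IV.B Thm 6 and Statement 8 (arXiv:2306.16400 chunk p0009 L66–74, p0010 L58–63)] -/
theorem cssMinDist_lp_eq (h : Ga ⊔ Gb = ⊤) (a b : G → ZMod 2) (ha : ∀ g, g ∉ Ga → a g = 0)
    (hb : ∀ g, g ∉ Gb → b g = 0) :
    cssMinDist (LiftedProduct.xMatrix (blocksA Ga Gb h a) (blocksB Ga Gb h b))
        (LiftedProduct.zMatrix (blocksA Ga Gb h a) (blocksB Ga Gb h b)) = cssMinDist (css a b).HX (css a b).HZ := by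
  rw [← css_HX_submatrix Ga Gb h a b ha hb, ← css_HZ_submatrix Ga Gb h a b ha hb,
    show (css a b).HX.submatrix (tripleEquiv Ga Gb h) (qubitEquiv Ga Gb h) =
      ((css a b).HX.submatrix (tripleEquiv Ga Gb h) id).submatrix id (qubitEquiv Ga Gb h) from rfl,
    show (css a b).HZ.submatrix (tripleEquiv Ga Gb h) (qubitEquiv Ga Gb h) =
      ((css a b).HZ.submatrix (tripleEquiv Ga Gb h) id).submatrix id (qubitEquiv Ga Gb h) from rfl,
    cssMinDist_submatrix_equiv, cssMinDist_submatrix_equiv_rows]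

/-! ### The four classical distances of Statement 12 -/

omit [DecidableEq G] in
/-- `d(ker 𝔅(A₁)) = d(ker 𝕃(a)) = d_A^⊥`. [cite: LinPryadko2024, Statement 12 and App. VIII.C (arXiv:2306.16400 chunk p0011 L101–110, p0018 L109–116)] -/
theorem minDist_pcCode_flat_blocksA (h : Ga ⊔ Gb = ⊤) (a : G → ZMod 2) (ha : ∀ g, g ∉ Ga → a g = 0) :
    Coding.minDist (pcCode (LiftedProduct.flat (blk Ga Gb (Ga ⊓ Gb) h a))) =
      Coding.minDist (pcCode (circulant a)) := by
  have : Nonempty (G ⧸ Ga) := ⟨((0 : G) : G ⧸ Ga)⟩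
  exact (minDist_pcCode_circulant_eq_of_fibration (Ga ⊓ Gb) Ga (tripleEquiv Ga Gb h) (repIn Ga Gb h)
    (repIn Gb Ga (sup_comm_eq_top Ga Gb h)) (fun _ _ _ => rfl) (repIn_mem Ga Gb h) inf_le_left
    (fun β β' => (repIn_sub_repIn_mem_iff Gb Ga _ β β').1) a ha).symm

omit [DecidableEq G] in
/-- `d(ker 𝔅(B₁)) = d(ker ℝ(b)) = d_B^⊥`. [cite: LinPryadko2024, Statement 12 and App. VIII.C (arXiv:2306.16400 chunk p0011 L101–110, p0018 L109–116)] -/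
theorem minDist_pcCode_flat_blocksB (h : Ga ⊔ Gb = ⊤) (b : G → ZMod 2) (hb : ∀ g, g ∉ Gb → b g = 0) :
    Coding.minDist (pcCode (LiftedProduct.flat (blk Gb Ga (Ga ⊓ Gb) (sup_comm_eq_top Ga Gb h) b))) =
      Coding.minDist (pcCode (circulant b)) := by
  have : Nonempty (G ⧸ Gb) := ⟨((0 : G) : G ⧸ Gb)⟩
  exact (minDist_pcCode_circulant_eq_of_fibration (Ga ⊓ Gb) Gb
    ((Equiv.prodCongr (Equiv.prodComm _ _) (Equiv.refl _)).trans (tripleEquiv Ga Gb h))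
    (repIn Gb Ga (sup_comm_eq_top Ga Gb h)) (repIn Ga Gb h)
    (fun β α γ => by simp [tripleEquiv_apply, tripleFun_apply, add_comm])
    (repIn_mem Gb Ga _) inf_le_right (fun α α' => (repIn_sub_repIn_mem_iff Ga Gb h α α').1) b hb).symm

omit [DecidableEq G] in
/-- `d(ker 𝔅(A₁)ᵀ) = d(ker 𝕃(a)ᵀ) = d(ker 𝕃(a))` (the transposed code is the code of the reversed `a`, equivalent
by `g ↦ −g`). [cite: LinPryadko2024, §IV.C (arXiv:2306.16400 chunk p0010 L74–75: "these parameters remain the same when the transposed matrices are used")] -/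
theorem minDist_pcCode_flat_blocksA_transpose (h : Ga ⊔ Gb = ⊤) (a : G → ZMod 2)
    (ha : ∀ g, g ∉ Ga → a g = 0) :
    Coding.minDist (pcCode (LiftedProduct.flat (blk Ga Gb (Ga ⊓ Gb) h a))ᵀ) =
      Coding.minDist (pcCode (circulant a)) := by
  rw [← flat_blk_neg_eq_transpose, minDist_pcCode_flat_blocksA Ga Gb h (fun g => a (-g))
    (fun g hg => ha (-g) (fun hn => hg (by simpa using Ga.neg_mem hn))), ← transpose_circulant,
    minDist_pcCode_circulant_transpose]

omit [DecidableEq G] in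
/-- `d(ker 𝔅(B₁)ᵀ) = d(ker ℝ(b))`. [cite: LinPryadko2024, §IV.C (arXiv:2306.16400 chunk p0010 L74–75)] -/
theorem minDist_pcCode_flat_blocksB_transpose (h : Ga ⊔ Gb = ⊤) (b : G → ZMod 2)
    (hb : ∀ g, g ∉ Gb → b g = 0) :
    Coding.minDist (pcCode (LiftedProduct.flat (blk Gb Ga (Ga ⊓ Gb) (sup_comm_eq_top Ga Gb h) b))ᵀ) =
      Coding.minDist (pcCode (circulant b)) := by
  rw [← flat_blk_neg_eq_transpose, minDist_pcCode_flat_blocksB Ga Gb h (fun g => b (-g))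
    (fun g hg => hb (-g) (fun hn => hg (by simpa using Gb.neg_mem hn))), ← transpose_circulant,
    minDist_pcCode_circulant_transpose]

/-! ### Statement 12 as printed, abelian `LP[a,b]` -/

/-- **Lin–Pryadko Statement 12 / Kovalev–Pryadko Thm 5 for abelian two-block codes, as printed.** For a finite
abelian `G`, `a, b ∈ 𝔽₂[G]` with support subgroups `G_a ⊇ supp a`, `G_b ⊇ supp b`, `G_a + G_b = G` (connected
double coset), `N = G_a ∩ G_b` of order `c`, and `d_A^⊥ = d(ker 𝕃(a))`, `d_B^⊥ = d(ker ℝ(b))` the distances of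
the classical group-algebra codes on `G`: if `c·(D − 1) < min(d_A^⊥, d_B^⊥)` then `D ≤ d(LP[a,b])` (Tillich–Zémor
`cssMinDist`, both sectors) — i.e. `d ≥ d₀ ≡ ⌈min(d_A^⊥, d_B^⊥)/c⌉` (`d_X = d_Z` for abelian `G`).
[cite: LinPryadko2024, Statement 12 (arXiv:2306.16400 chunk p0011 L101–110: "the distance d_Z of the code LP[a,b] satisfies d_Z ≥ d₀ ≡ ⌈min(d_A^⊥,d_B^⊥)/c⌉")]
[cite: KovalevPryadko2013Hyperbicycle, Thm 5 (arXiv:1212.6703 chunk p0011 L83–88)] -/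
theorem le_cssMinDist_css_of_card_mul_lt (h : Ga ⊔ Gb = ⊤) (a b : G → ZMod 2) (ha : ∀ g, g ∉ Ga → a g = 0)
    (hb : ∀ g, g ∉ Gb → b g = 0) (D : ℕ)
    (hD : ((Fintype.card ↥(Ga ⊓ Gb) * (D - 1) : ℕ) : ℕ∞) <
      min (Coding.minDist (pcCode (circulant a))) (Coding.minDist (pcCode (circulant b)))) :
    (D : ℕ∞) ≤ cssMinDist (css a b).HX (css a b).HZ := by
  rw [← cssMinDist_lp_eq Ga Gb h a b ha hb]
  refine LiftedProduct.le_cssMinDist_of_card_mul_lt _ _ D ?_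
  rwa [minDist_pcCode_flat_blocksA Ga Gb h a ha, minDist_pcCode_flat_blocksB Ga Gb h b hb,
    minDist_pcCode_flat_blocksA_transpose Ga Gb h a ha, minDist_pcCode_flat_blocksB_transpose Ga Gb h b hb,
    min_self]

/-- `ℕ`-valued `Z`-distance form: `c·(D − 1) < min(d_A^⊥, d_B^⊥)` and `k > 0 ⟹ D ≤ d_Z(LP[a,b])`.
[cite: LinPryadko2024, Statement 12 (arXiv:2306.16400 chunk p0011 L101–110)] -/
theorem le_css_dZ_of_card_mul_lt (h : Ga ⊔ Gb = ⊤) (a b : G → ZMod 2) (ha : ∀ g, g ∉ Ga → a g = 0)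
    (hb : ∀ g, g ∉ Gb → b g = 0) (hk : 0 < (css a b).k) (D : ℕ)
    (hD : ((Fintype.card ↥(Ga ⊓ Gb) * (D - 1) : ℕ) : ℕ∞) <
      min (Coding.minDist (pcCode (circulant a))) (Coding.minDist (pcCode (circulant b)))) :
    D ≤ (css a b).dZ := by
  have h1 := le_cssMinDist_css_of_card_mul_lt Ga Gb h a b ha hb D hD
  rw [(css a b).cssMinDist_eq_min_dX_dZ hk] at h1
  exact (Nat.cast_le.1 h1).trans (min_le_right _ _)

/-- `ℕ`-valued `X`-distance form. [cite: LinPryadko2024, Statement 12 and §IV.B (abelian G: d_X = d_Z) (arXiv:2306.16400 chunk p0011 L101–110, p0009 L103–106)] -/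
theorem le_css_dX_of_card_mul_lt (h : Ga ⊔ Gb = ⊤) (a b : G → ZMod 2) (ha : ∀ g, g ∉ Ga → a g = 0)
    (hb : ∀ g, g ∉ Gb → b g = 0) (hk : 0 < (css a b).k) (D : ℕ)
    (hD : ((Fintype.card ↥(Ga ⊓ Gb) * (D - 1) : ℕ) : ℕ∞) <
      min (Coding.minDist (pcCode (circulant a))) (Coding.minDist (pcCode (circulant b)))) :
    D ≤ (css a b).dX := by
  rw [css_dX_eq_dZ]
  exact le_css_dZ_of_card_mul_lt Ga Gb h a b ha hb hk D hD

end Identification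

end AbelianTwoBlock

end Literature.InformationTheory.QuantumCodes
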